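/-
Origin: expansion seat `prover-pub-hodgecm-mc-carch-1-0`, handover #CA6 2026-08-19T23:18Z md5 33d8d14cfcf8 (191 l.; NEW additive leaf; imports Model.ArchKTypeOfArch (#CA2) only) (`HOME/mc/pub-hodgecm-mc-carch-1/pkg/HodgeCM/Model/ArchKTypeOfSection.lean`, md5 33d8d14cfcf8, 191 lines);
landed by the second packager (p2) in gate run 38 as `HodgeCM/Model/ArchKTypeOfSection.lean` (verbatim).
-/
/-
Copyright (c) 2026. Released under Apache 2.0 license as described in the file LICENSE.
Cell pub-hodgecm, MODEL layer (construction prover mc-carch-1, gen 0), BINDER-OWNERS row 12 `C`, junction (J-x₀)⇄(J-arch): the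
PLACE COMPONENTS of the `ι₁`-section in the rational CM frame (`Model/ArchKTypeOfArch.archSectionFrameOf`), as explicit matrices —
the left-hand side of the frame-matching statement `hωA` of `Model/ArchKTypeOfFrame`.
-/
import Summits.HodgeConjecture.HodgeCM.Model.ArchKTypeOfArch

/-!
# The components of `archSectionFrameOf V u` at the complex places of `L`

`archSectionFrameOf V : U21 →* U(diag (frameD V))(L ⊗ ℝ)` (#CA2) is `g_∞⁻¹ · (T u T⁻¹ at w(ι₁) through embTwist, 1 elsewhere) · g_∞`
with `g = frameG V` the rational CM frame and `T = V.sylvesterFrame = g^{ι₁} ∘ σ · D` (`Junction/SylvesterFrame`).  This file reads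
its components `archAt w (archSectionFrameOf V u) ∈ GL₃(ℂ)`:

* § 1 (generic) `toMixed_toAdeleGL` (`(g_𝔸)_∞ = GL₃(mixedEmbedding) g`), **`coe_archFrameCongr`**
  (`archFrameCongr g x = (GL(mixedEmbedding) g)⁻¹ · x · GL(mixedEmbedding) g` in `GL_N(L ⊗ ℝ)`), and per place
  **`coe_archAt_archFrameCongr`**: `(archFrameCongr g x)_w = (GL(w.embedding) g)⁻¹ · x_w · GL(w.embedding) g`;
* § 2 (the pin) **`coe_archAt_archSectionFrameOf_cmPlace`**: at `w(ι₁)` the component is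
  `(GL((mk ι₁).embedding) (frameG V))⁻¹ · GL(embTwist L ι₁) (T u T⁻¹) · GL((mk ι₁).embedding) (frameG V)`,
  and **`archAt_archSectionFrameOf_of_ne`**: at every other complex place it is `1`.

With `(mk ι₁).embedding = embTwist ∘ ι₁` (`embTwist_apply_apply`) and `T = ι₁(g) · P_σ · D` the `w(ι₁)`-component is
`GL(embTwist) (P_σ D · u · (P_σ D)⁻¹)` — the matrix the frame matching (J-x₀)⇄(J-arch) compares with binder-2's block section (see the
TWIST NOTE of `Model/ArchKTypeOfFrame`).  Nothing is cited and nothing is minted: kernel lemmas on installed definitions.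
-/

set_option autoImplicit false

noncomputable section

open NumberField NumberField.InfinitePlace NumberField.mixedEmbedding IsDedekindDomain
open scoped Matrix Classical
open Literature.Geometry.ComplexHyperbolic.BallModel (U21)
open Literature.NumberTheory.Automorphic
open Literature.NumberTheory.GelbartRogawski1991 Literature.NumberTheory.GelbartRogawski1991.UnitaryDualPair

namespace HodgeCM
namespace Model

/-! ### § 1. Components of the archimedean frame transport -/

section Frame

variable (L : Type) [Field L] [NumberField L] [IsCMField L] {N : ℕ} (H : Matrix (Fin N) (Fin N) L)
  (g : GL (Fin N) L) (d : Fin N → L)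
  (hg : ((g : Matrix (Fin N) (Fin N) L).map (cmConjRingHom L))ᵀ * H * (g : Matrix (Fin N) (Fin N) L) = Matrix.diagonal d)

omit [IsCMField L] in
/-- `(g_𝔸)_∞ = GL_N(mixedEmbedding) g`: the archimedean component of the diagonal image of `g ∈ GL_N(L)`. -/
theorem toMixed_toAdeleGL (g : GL (Fin N) L) :
    GLn.toMixed N L (toAdeleGL L g) = Matrix.GeneralLinearGroup.map (NumberField.mixedEmbedding L) g := by
  refine Matrix.GeneralLinearGroup.ext fun i j => ?_
  show InfiniteAdeleRing.ringEquiv_mixedSpace L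
      ((algebraMap L (AdeleRing (𝓞 L) L) ((g : Matrix (Fin N) (Fin N) L) i j)).1) =
    NumberField.mixedEmbedding L ((g : Matrix (Fin N) (Fin N) L) i j)
  rw [InfiniteAdeleRing.mixedEmbedding_eq_algebraMap_comp]
  rfl

/-- **`archFrameCongr g x = (GL(mixedEmbedding) g)⁻¹ · x · GL(mixedEmbedding) g`** in `GL_N(L ⊗ ℝ)`. -/
theorem coe_archFrameCongr (x : UnitaryGroup.arch (↥(maximalRealSubfield L)) L (IsCMField.complexConj L) N H) :
    ((archFrameCongr L H g d hg x :
        UnitaryGroup.arch (↥(maximalRealSubfield L)) L (IsCMField.complexConj L) N (Matrix.diagonal d)) :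
          GL (Fin N) (mixedSpace L)) =
      (Matrix.GeneralLinearGroup.map (NumberField.mixedEmbedding L) g)⁻¹ * (x : GL (Fin N) (mixedSpace L)) *
        Matrix.GeneralLinearGroup.map (NumberField.mixedEmbedding L) g := by
  rw [archFrameCongr_apply, UnitaryGroup.coe_archPart]
  change GLn.toMixed N L ((cmKTypeHom L H g d hg
      (UnitaryGroup.archToAdelic (↥(maximalRealSubfield L)) L (IsCMField.complexConj L) N H x) :
        ↥(UnitaryGroup.adelic (↥(maximalRealSubfield L)) L (IsCMField.complexConj L) N (Matrix.diagonal d))) :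
          GL (Fin N) (AdeleRing (𝓞 L) L)) = _
  rw [coe_cmKTypeHom, map_mul, map_mul, map_inv, toMixed_toAdeleGL]
  change _ * GLn.toMixed N L (GLn.ofInfinite N L (x : GL (Fin N) (mixedSpace L))) * _ = _
  rw [GLn.toMixed_ofInfinite]

omit [NumberField L] [IsCMField L] in
/-- `evalC w ∘ mixedEmbedding = w.embedding` on `GL_N`. -/
theorem generalLinearGroup_map_evalC_map_mixedEmbedding (w : {w : InfinitePlace L // w.IsComplex}) (g : GL (Fin N) L) :
    Matrix.GeneralLinearGroup.map (UnitaryGroup.evalC L w)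
        (Matrix.GeneralLinearGroup.map (NumberField.mixedEmbedding L) g) =
      Matrix.GeneralLinearGroup.map (w.1.embedding : L →+* ℂ) g := by
  refine Matrix.GeneralLinearGroup.ext fun i j => ?_
  show UnitaryGroup.evalC L w (NumberField.mixedEmbedding L ((g : Matrix (Fin N) (Fin N) L) i j)) =
    w.1.embedding ((g : Matrix (Fin N) (Fin N) L) i j)
  rw [UnitaryGroup.evalC_apply, mixedEmbedding_apply_isComplex]

/-- **The `w`-component of the archimedean frame transport**:
`(archFrameCongr g x)_w = (GL(w.embedding) g)⁻¹ · x_w · GL(w.embedding) g`. -/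
theorem coe_archAt_archFrameCongr (w : {w : InfinitePlace L // w.IsComplex})
    (x : UnitaryGroup.arch (↥(maximalRealSubfield L)) L (IsCMField.complexConj L) N H) :
    ((UnitaryGroup.archAt (↥(maximalRealSubfield L)) L (IsCMField.complexConj L) N (Matrix.diagonal d) w
        (NumberField.complexConj_smul_infinitePlace L w.1) (IsCMField.complexConj_ne_one L)
        (archFrameCongr L H g d hg x) :
          UnitaryGroup.archLocal L N (Matrix.diagonal d) w) : GL (Fin N) ℂ) =
      (Matrix.GeneralLinearGroup.map (w.1.embedding : L →+* ℂ) g)⁻¹ *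
        ((UnitaryGroup.archAt (↥(maximalRealSubfield L)) L (IsCMField.complexConj L) N H w
            (NumberField.complexConj_smul_infinitePlace L w.1) (IsCMField.complexConj_ne_one L) x :
              UnitaryGroup.archLocal L N H w) : GL (Fin N) ℂ) *
        Matrix.GeneralLinearGroup.map (w.1.embedding : L →+* ℂ) g := by
  rw [UnitaryGroup.coe_archAt, coe_archFrameCongr, map_mul, map_mul, map_inv,
    generalLinearGroup_map_evalC_map_mixedEmbedding, UnitaryGroup.coe_archAt]

end Frame

/-! ### § 2. The components of the `ι₁`-section of the pin -/

section PinSection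

variable {L : CMField} {ι₁ : L →+* ℂ} (V : HermSpace3 L ι₁)

/-- **At the place `w(ι₁)`**: the component of #1097's section is `GL₃(embTwist L ι₁) (T u T⁻¹)`, `T = V.sylvesterFrame`. -/
theorem coe_archAt_archSectionArchOf_cmPlace (u : U21) :
    ((UnitaryGroup.archAt (↥(maximalRealSubfield L)) L (IsCMField.complexConj L) 3 V.Hm (UnitaryGroup.cmPlace (L : Type) ι₁)
        (NumberField.complexConj_smul_infinitePlace (L : Type) _) (IsCMField.complexConj_ne_one (L : Type))
        (archSectionArchOf V u) : UnitaryGroup.archLocal (L : Type) 3 V.Hm (UnitaryGroup.cmPlace (L : Type) ι₁)) :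
          GL (Fin 3) ℂ) =
      Matrix.GeneralLinearGroup.map (UnitaryGroup.embTwist (L : Type) ι₁)
        (V.sylvesterFrame * (u : GL (Fin 3) ℂ) * V.sylvesterFrame⁻¹) := by
  simp only [archSectionArchOf, MonoidHom.comp_apply, UnitaryGroup.archSectionU21CM, UnitaryGroup.archSectionU21Emb_apply,
    UnitaryGroup.archPart_adelicSingle, UnitaryGroup.archAt_archSingle_self]
  rfl

/-- **Away from `w(ι₁)`**: the component of #1097's section is `1`. -/
theorem archAt_archSectionArchOf_of_ne {w : {w : InfinitePlace (L : Type) // w.IsComplex}}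
    (h : w ≠ UnitaryGroup.cmPlace (L : Type) ι₁) (u : U21) :
    UnitaryGroup.archAt (↥(maximalRealSubfield L)) L (IsCMField.complexConj L) 3 V.Hm w
        (NumberField.complexConj_smul_infinitePlace (L : Type) _) (IsCMField.complexConj_ne_one (L : Type))
        (archSectionArchOf V u) = 1 := by
  simp only [archSectionArchOf, MonoidHom.comp_apply, UnitaryGroup.archSectionU21CM, UnitaryGroup.archSectionU21Emb_apply,
    UnitaryGroup.archPart_adelicSingle, UnitaryGroup.archAt_archSingle_of_ne _ _ _ _ _ _ _ _ h]

/-- **The `w(ι₁)`-component of the `ι₁`-section in the rational CM frame**: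
`(GL((mk ι₁).embedding) g)⁻¹ · GL(embTwist L ι₁) (T u T⁻¹) · GL((mk ι₁).embedding) g`, `g = frameG V`, `T = V.sylvesterFrame`
(and `(mk ι₁).embedding = embTwist L ι₁ ∘ ι₁`, `T = ι₁(g) ∘ σ · D` — `UnitaryGroup.embTwist_apply_apply`,
`HermSpace3.sylvesterFrame_eq_rationalFrame_adapted` — so this is `GL(embTwist) (P_σ D · u · (P_σ D)⁻¹)`). -/
theorem coe_archAt_archSectionFrameOf_cmPlace (u : U21) :
    ((UnitaryGroup.archAt (↥(maximalRealSubfield L)) L (IsCMField.complexConj L) 3 (Matrix.diagonal (frameD V))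
        (UnitaryGroup.cmPlace (L : Type) ι₁)
        (NumberField.complexConj_smul_infinitePlace (L : Type) _) (IsCMField.complexConj_ne_one (L : Type))
        (archSectionFrameOf V u) :
          UnitaryGroup.archLocal (L : Type) 3 (Matrix.diagonal (frameD V)) (UnitaryGroup.cmPlace (L : Type) ι₁)) :
            GL (Fin 3) ℂ) =
      (Matrix.GeneralLinearGroup.map ((UnitaryGroup.cmPlace (L : Type) ι₁).1.embedding : (L : Type) →+* ℂ) (frameG V))⁻¹ *
        Matrix.GeneralLinearGroup.map (UnitaryGroup.embTwist (L : Type) ι₁)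
          (V.sylvesterFrame * (u : GL (Fin 3) ℂ) * V.sylvesterFrame⁻¹) *
        Matrix.GeneralLinearGroup.map ((UnitaryGroup.cmPlace (L : Type) ι₁).1.embedding : (L : Type) →+* ℂ) (frameG V) := by
  rw [archSectionFrameOf_apply, coe_archAt_archFrameCongr, coe_archAt_archSectionArchOf_cmPlace]

/-- **Away from `w(ι₁)` the `ι₁`-section in the rational CM frame is trivial.** -/
theorem archAt_archSectionFrameOf_of_ne {w : {w : InfinitePlace (L : Type) // w.IsComplex}}
    (h : w ≠ UnitaryGroup.cmPlace (L : Type) ι₁) (u : U21) :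
    UnitaryGroup.archAt (↥(maximalRealSubfield L)) L (IsCMField.complexConj L) 3 (Matrix.diagonal (frameD V)) w
        (NumberField.complexConj_smul_infinitePlace (L : Type) _) (IsCMField.complexConj_ne_one (L : Type))
        (archSectionFrameOf V u) = 1 := by
  apply Subtype.ext
  apply Units.ext
  have h1 := coe_archAt_archFrameCongr (L : Type) V.Hm (frameG V) (frameD V) (frame_congr V) w (archSectionArchOf V u)
  rw [archAt_archSectionArchOf_of_ne V h u, OneMemClass.coe_one, mul_one, inv_mul_cancel] at h1
  rw [archSectionFrameOf_apply]
  exact congrArg (fun x : GL (Fin 3) ℂ => (x : Matrix (Fin 3) (Fin 3) ℂ)) h1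

/-- `GL₃((mk ι₁).embedding) g = GL₃(embTwist L ι₁) (GL₃(ι₁) g)` (`embTwist_apply_apply`, entrywise). -/
theorem generalLinearGroup_map_embedding_mk (g : GL (Fin 3) (L : Type)) :
    Matrix.GeneralLinearGroup.map ((UnitaryGroup.cmPlace (L : Type) ι₁).1.embedding : (L : Type) →+* ℂ) g =
      Matrix.GeneralLinearGroup.map (UnitaryGroup.embTwist (L : Type) ι₁) (Matrix.GeneralLinearGroup.map ι₁ g) := by
  refine Matrix.GeneralLinearGroup.ext fun i j => ?_
  show (InfinitePlace.mk ι₁).embedding ((g : Matrix (Fin 3) (Fin 3) (L : Type)) i j) =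
    UnitaryGroup.embTwist (L : Type) ι₁ (ι₁ ((g : Matrix (Fin 3) (Fin 3) (L : Type)) i j))
  rw [UnitaryGroup.embTwist_apply_apply]

/-- **The `w(ι₁)`-component with the twist pulled out**: `GL(embTwist L ι₁) ((ι₁ g)⁻¹ · T u T⁻¹ · ι₁ g)`, i.e. the conjugate of
`u` by `(ι₁ g)⁻¹ T = P_σ · D` (`HermSpace3.sylvesterFrame_eq_rationalFrame_adapted`), read through `embTwist`. -/
theorem coe_archAt_archSectionFrameOf_cmPlace' (u : U21) :
    ((UnitaryGroup.archAt (↥(maximalRealSubfield L)) L (IsCMField.complexConj L) 3 (Matrix.diagonal (frameD V))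
        (UnitaryGroup.cmPlace (L : Type) ι₁)
        (NumberField.complexConj_smul_infinitePlace (L : Type) _) (IsCMField.complexConj_ne_one (L : Type))
        (archSectionFrameOf V u) :
          UnitaryGroup.archLocal (L : Type) 3 (Matrix.diagonal (frameD V)) (UnitaryGroup.cmPlace (L : Type) ι₁)) :
            GL (Fin 3) ℂ) =
      Matrix.GeneralLinearGroup.map (UnitaryGroup.embTwist (L : Type) ι₁)
        ((Matrix.GeneralLinearGroup.map ι₁ (frameG V))⁻¹ * (V.sylvesterFrame * (u : GL (Fin 3) ℂ) * V.sylvesterFrame⁻¹) *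
          Matrix.GeneralLinearGroup.map ι₁ (frameG V)) := by
  rw [coe_archAt_archSectionFrameOf_cmPlace, generalLinearGroup_map_embedding_mk]
  simp only [map_mul, map_inv]

end PinSection

end Model
end HodgeCM

end
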